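import Literature.Geometry.Riemannian.ChernTransgressionAlgebra
import Mathlib.Analysis.Calculus.FDeriv.Symmetric
import Mathlib.Analysis.Calculus.ContDiff.Operations
import Mathlib.Analysis.Calculus.Deriv.Inv
import Mathlib.Analysis.SpecialFunctions.Sqrt
import Mathlib.Analysis.Matrix.PosDef
import Mathlib.Analysis.Matrix.Normed
import Mathlib.Analysis.Calculus.LineDeriv.Basic

/-!
# Chern's transgression identity in coordinates: the calculus and the discharge

Third support file (after `ChernTransgressionFock`, `ChernTransgressionAlgebra`) for, and discharge
of, the named fact `Literature.Geometry.Riemannian.div_chernTransgression_eq_eulerDensity` of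
`ChernTransgression.lean`:
coordinate calculus of a `C³` metric (`coordPartial` rules, symmetry of second partials,
metric compatibility `∂ₖg = gΓₖ + Γₖᵀg`, the structure equation for the unit field, the second
Bianchi identity in matrix form, Jacobi's formula), the operator-valued derivative of the
transgression element, and the discharge `div_chernTransgression_eq_eulerDensity_holds`.
[cite: Chern1945, (11)]
-/

noncomputable section

open Finset Matrix
open scoped Nat Topology

namespace Literature.Geometry.Riemannian

variable {d : ℕ}

/-! ### Coordinate calculus: rules for `coordPartial` -/

section CoordCalculus

variable {f g : (Fin d → ℝ) → ℝ} {x : Fin d → ℝ} (k : Fin d)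

/-- Sum rule. [folklore] -/
theorem coordPartial_add (hf : DifferentiableAt ℝ f x) (hg : DifferentiableAt ℝ g x) :
    coordPartial k (fun y => f y + g y) x = coordPartial k f x + coordPartial k g x := by
  simp only [coordPartial, fderiv_fun_add hf hg, _root_.add_apply]

/-- Difference rule. [folklore] -/
theorem coordPartial_sub (hf : DifferentiableAt ℝ f x) (hg : DifferentiableAt ℝ g x) :
    coordPartial k (fun y => f y - g y) x = coordPartial k f x - coordPartial k g x := by
  simp only [coordPartial, fderiv_fun_sub hf hg, _root_.sub_apply]

/-- Negation rule. [folklore] -/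
theorem coordPartial_neg (f : (Fin d → ℝ) → ℝ) (x : Fin d → ℝ) :
    coordPartial k (fun y => -f y) x = -coordPartial k f x := by
  simp only [coordPartial, fderiv_fun_neg, _root_.neg_apply]

/-- Constant multiple rule. [folklore] -/
theorem coordPartial_const_mul (hf : DifferentiableAt ℝ f x) (c : ℝ) :
    coordPartial k (fun y => c * f y) x = c * coordPartial k f x := by
  simp only [coordPartial, fderiv_const_mul hf c, _root_.smul_apply, smul_eq_mul]

/-- Product rule. [folklore] -/
theorem coordPartial_mul (hf : DifferentiableAt ℝ f x) (hg : DifferentiableAt ℝ g x) :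
    coordPartial k (fun y => f y * g y) x = coordPartial k f x * g x + f x * coordPartial k g x := by
  simp only [coordPartial, fderiv_fun_mul hf hg, _root_.add_apply,
    _root_.smul_apply, smul_eq_mul]
  ring

/-- Finite sum rule. [folklore] -/
theorem coordPartial_sum {ι : Type*} (s : Finset ι) {F : ι → (Fin d → ℝ) → ℝ}
    (hF : ∀ i ∈ s, DifferentiableAt ℝ (F i) x) :
    coordPartial k (fun y => ∑ i ∈ s, F i y) x = ∑ i ∈ s, coordPartial k (F i) x := by
  simp only [coordPartial, fderiv_fun_sum hF, _root_.sum_apply]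

/-- Reciprocal rule. [folklore] -/
theorem coordPartial_inv (hf : DifferentiableAt ℝ f x) (hx : f x ≠ 0) :
    coordPartial k (fun y => (f y)⁻¹) x = -coordPartial k f x / f x ^ 2 := by
  have h : HasFDerivAt (fun y => (f y)⁻¹) ((-(f x ^ 2)⁻¹) • fderiv ℝ f x) x :=
    (hasDerivAt_inv hx).comp_hasFDerivAt x hf.hasFDerivAt
  simp only [coordPartial, h.fderiv, _root_.smul_apply, smul_eq_mul]
  ring

/-- Square-root rule. [folklore] -/
theorem coordPartial_sqrt (hf : DifferentiableAt ℝ f x) (hx : f x ≠ 0) :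
    coordPartial k (fun y => Real.sqrt (f y)) x = coordPartial k f x / (2 * Real.sqrt (f x)) := by
  simp only [coordPartial, (hf.hasFDerivAt.sqrt hx).fderiv, _root_.smul_apply,
    smul_eq_mul]
  ring

/-- Locality: functions agreeing near `x` have the same partials at `x`. [folklore] -/
theorem coordPartial_congr (h : f =ᶠ[𝓝 x] g) : coordPartial k f x = coordPartial k g x := by
  simp only [coordPartial, h.fderiv_eq]

/-- Differentiability from `ContDiffOn` on an open set. [folklore] -/
theorem differentiableAt_of_contDiffOn {n : WithTop ℕ∞} {U : Set (Fin d → ℝ)}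
    (hf : ContDiffOn ℝ n f U) (hU : IsOpen U) (hx : x ∈ U) (hn : n ≠ 0) :
    DifferentiableAt ℝ f x :=
  (hf.differentiableOn hn).differentiableAt (hU.mem_nhds hx)

/-- Partial derivatives of `C^{m+1}` functions are `C^m` (open set). [folklore] -/
theorem contDiffOn_coordPartial_of_succ_le {n m : WithTop ℕ∞} {U : Set (Fin d → ℝ)}
    (hf : ContDiffOn ℝ n f U) (hU : IsOpen U) (hmn : m + 1 ≤ n) :
    ContDiffOn ℝ m (coordPartial k f) U := by
  have : coordPartial k f = fun y => (fderiv ℝ f y) (Pi.single k 1) := rfl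
  rw [this]
  exact (hf.fderiv_of_isOpen hU hmn).clm_apply contDiffOn_const

/-- Second partials as values of the second Fréchet derivative. [folklore] -/
theorem coordPartial_coordPartial (hf : ContDiffAt ℝ 2 f x) (k l : Fin d) :
    coordPartial k (coordPartial l f) x = fderiv ℝ (fderiv ℝ f) x (Pi.single k 1) (Pi.single l 1) := by
  have hd : DifferentiableAt ℝ (fderiv ℝ f) x :=
    (hf.fderiv_right (m := 1) (by norm_num)).differentiableAt one_ne_zero
  show fderiv ℝ (fun y => fderiv ℝ f y (Pi.single l 1)) x (Pi.single k 1) = _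
  rw [fderiv_clm_apply hd (differentiableAt_const _)]
  simp

/-- **Symmetry of second partials** for a `C²` function. [folklore] -/
theorem coordPartial_comm (hf : ContDiffAt ℝ 2 f x) (k l : Fin d) :
    coordPartial k (coordPartial l f) x = coordPartial l (coordPartial k f) x := by
  rw [coordPartial_coordPartial hf, coordPartial_coordPartial hf]
  exact (hf.isSymmSndFDerivAt (by simp)) _ _

end CoordCalculus

/-! ### Determinants and inverses of matrix-valued `C^n` maps (entrywise) -/

section MatrixCalculus

variable {n : WithTop ℕ∞} {U : Set (Fin d → ℝ)} {M : (Fin d → ℝ) → Matrix (Fin d) (Fin d) ℝ}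

/-- The determinant of an entrywise-`C^n` matrix function is `C^n`. [folklore] -/
theorem contDiffOn_det (hM : ∀ i j, ContDiffOn ℝ n (fun x => M x i j) U) :
    ContDiffOn ℝ n (fun x => (M x).det) U := by
  simp only [Matrix.det_apply']
  refine ContDiffOn.sum fun σ _ => ContDiffOn.mul contDiffOn_const ?_
  exact contDiffOn_prod fun i _ => hM _ _

/-- The adjugate of an entrywise-`C^n` matrix function is entrywise `C^n`. [folklore] -/
theorem contDiffOn_adjugate (hM : ∀ i j, ContDiffOn ℝ n (fun x => M x i j) U) (i j : Fin d) :
    ContDiffOn ℝ n (fun x => (M x).adjugate i j) U := by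
  simp only [Matrix.adjugate_apply]
  refine contDiffOn_det fun a b => ?_
  simp only [Matrix.updateRow_apply]
  by_cases ha : a = j
  · simp only [ha, if_true]
    exact contDiffOn_const
  · simp only [ha, if_false]
    exact hM a b

/-- The inverse of an entrywise-`C^n` matrix function with nonvanishing determinant is entrywise
`C^n`. [folklore] -/
theorem contDiffOn_inv_entry (hM : ∀ i j, ContDiffOn ℝ n (fun x => M x i j) U)
    (hdet : ∀ x ∈ U, (M x).det ≠ 0) (i j : Fin d) :
    ContDiffOn ℝ n (fun x => (M x)⁻¹ i j) U := by
  have : (fun x => (M x)⁻¹ i j) = fun x => ((M x).det)⁻¹ * (M x).adjugate i j := by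
    funext x
    rw [Matrix.inv_def, Ring.inverse_eq_inv', Matrix.smul_apply, smul_eq_mul]
  rw [this]
  exact ((contDiffOn_det hM).inv hdet).mul (contDiffOn_adjugate hM i j)

end MatrixCalculus

/-! ### The setting: a `C³` positive definite metric and a `C²` nonvanishing vector field -/

/-- The data and hypotheses of `div_chernTransgression_eq_eulerDensity`, bundled. [folklore] -/
structure ChernSetting (d : ℕ) where
  /-- domain of the metric -/
  U : Set (Fin d → ℝ)
  /-- domain of the vector field -/
  W : Set (Fin d → ℝ)
  /-- the coordinate metric -/
  g : (Fin d → ℝ) → Matrix (Fin d) (Fin d) ℝ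
  /-- the vector field -/
  V : (Fin d → ℝ) → (Fin d → ℝ)
  hU : IsOpen U
  hW : IsOpen W
  hWU : W ⊆ U
  hg : ∀ x ∈ U, (g x).PosDef
  hgs : ∀ i j, ContDiffOn ℝ 3 (fun x => g x i j) U
  hV : ContDiffOn ℝ 2 V W
  hV0 : ∀ x ∈ W, V x ≠ 0

namespace ChernSetting

variable (S : ChernSetting d)

/-- The metric is symmetric. [folklore] -/
theorem g_symm {x : Fin d → ℝ} (hx : x ∈ S.U) (i j : Fin d) : S.g x j i = S.g x i j := by
  have h := (S.hg x hx).isHermitian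
  have := congrFun (congrFun h.eq i) j
  simpa [Matrix.conjTranspose_apply] using this

/-- The metric is symmetric as a function on `U` (eventually near every point of `U`).
[folklore] -/
theorem g_symm_eventually {x : Fin d → ℝ} (hx : x ∈ S.U) (i j : Fin d) :
    (fun y => S.g y j i) =ᶠ[𝓝 x] fun y => S.g y i j := by
  filter_upwards [S.hU.mem_nhds hx] with y hy
  exact S.g_symm hy i j

/-- The determinant is positive on `U`. [folklore] -/
theorem det_pos {x : Fin d → ℝ} (hx : x ∈ S.U) : 0 < (S.g x).det := (S.hg x hx).det_pos

/-- The determinant is a unit on `U`. [folklore] -/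
theorem isUnit_det {x : Fin d → ℝ} (hx : x ∈ S.U) : IsUnit (S.g x).det :=
  isUnit_iff_ne_zero.mpr (S.det_pos hx).ne'

/-- `g g⁻¹ = 1` on `U`. [folklore] -/
theorem mul_inv {x : Fin d → ℝ} (hx : x ∈ S.U) : S.g x * (S.g x)⁻¹ = 1 :=
  Matrix.mul_nonsing_inv _ (S.isUnit_det hx)

/-- `g⁻¹ g = 1` on `U`. [folklore] -/
theorem inv_mul {x : Fin d → ℝ} (hx : x ∈ S.U) : (S.g x)⁻¹ * S.g x = 1 :=
  Matrix.nonsing_inv_mul _ (S.isUnit_det hx)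

/-- The inverse metric is symmetric. [folklore] -/
theorem ginv_symm {x : Fin d → ℝ} (hx : x ∈ S.U) (i j : Fin d) : (S.g x)⁻¹ j i = (S.g x)⁻¹ i j := by
  have hT : (S.g x)ᵀ = S.g x := Matrix.ext fun a b => S.g_symm hx a b
  have := congrFun (congrFun (Matrix.transpose_nonsing_inv (S.g x)) i) j
  rw [hT, Matrix.transpose_apply] at this
  exact this

/-! #### Regularity of the derived quantities -/

/-- Entries of `g`: `C³` on `U`. [folklore] -/
theorem cd_g (i j : Fin d) : ContDiffOn ℝ 3 (fun x => S.g x i j) S.U := S.hgs i j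

/-- First partials of `g`: `C²` on `U`. [folklore] -/
theorem cd_dg (k i j : Fin d) : ContDiffOn ℝ 2 (coordPartial k fun x => S.g x i j) S.U :=
  contDiffOn_coordPartial_of_succ_le k (S.cd_g i j) S.hU (by norm_num)

/-- Entries of `g⁻¹`: `C³` on `U`. [folklore] -/
theorem cd_ginv (i j : Fin d) : ContDiffOn ℝ 3 (fun x => (S.g x)⁻¹ i j) S.U :=
  contDiffOn_inv_entry S.hgs (fun _ hx => (S.det_pos hx).ne') i j

/-- Christoffel symbols: `C²` on `U`. [folklore] -/
theorem cd_Γ (a k b : Fin d) : ContDiffOn ℝ 2 (fun x => coordChristoffel S.g x a k b) S.U := by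
  unfold coordChristoffel
  refine ContDiffOn.mul contDiffOn_const (ContDiffOn.sum fun l _ => ?_)
  refine ((S.cd_ginv a l).of_le (by norm_num)).mul ?_
  exact ((S.cd_dg k l b).add (S.cd_dg b k l)).sub (S.cd_dg l k b)

/-- First partials of the Christoffel symbols: `C¹` on `U`. [folklore] -/
theorem cd_dΓ (m a k b : Fin d) :
    ContDiffOn ℝ 1 (coordPartial m fun x => coordChristoffel S.g x a k b) S.U :=
  contDiffOn_coordPartial_of_succ_le m (S.cd_Γ a k b) S.hU (by norm_num)

/-- The curvature endomorphism: `C¹` on `U`. [folklore] -/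
theorem cd_Rup (a b k l : Fin d) : ContDiffOn ℝ 1 (fun x => coordRiemannUp S.g x a b k l) S.U := by
  unfold coordRiemannUp
  refine ((S.cd_dΓ k a l b).sub (S.cd_dΓ l a k b)).add (ContDiffOn.sum fun m _ => ?_)
  exact (((S.cd_Γ a k m).of_le (by norm_num)).mul ((S.cd_Γ m l b).of_le (by norm_num))).sub
    (((S.cd_Γ a l m).of_le (by norm_num)).mul ((S.cd_Γ m k b).of_le (by norm_num)))

/-- The covariant curvature: `C¹` on `U`. [folklore] -/
theorem cd_R (a b k l : Fin d) : ContDiffOn ℝ 1 (fun x => coordRiemann S.g x a b k l) S.U := by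
  unfold coordRiemann
  exact ContDiffOn.sum fun m _ => ((S.cd_g a m).of_le (by norm_num)).mul (S.cd_Rup m b k l)

/-- Components of `V`: `C²` on `W`. [folklore] -/
theorem cd_V (a : Fin d) : ContDiffOn ℝ 2 (fun x => S.V x a) S.W := contDiffOn_pi.mp S.hV a

/-- `|V|²_g`: `C²` on `W`. [folklore] -/
theorem cd_normSq : ContDiffOn ℝ 2 (fun x => metricNormSq S.g x (S.V x)) S.W := by
  unfold metricNormSq dotProduct Matrix.mulVec dotProduct
  refine ContDiffOn.sum fun a _ => (S.cd_V a).mul (ContDiffOn.sum fun b _ => ?_)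
  exact (((S.cd_g a b).mono S.hWU).of_le (by norm_num)).mul (S.cd_V b)

/-- `|V|²_g > 0` on `W`. [folklore] -/
theorem normSq_pos {x : Fin d → ℝ} (hx : x ∈ S.W) : 0 < metricNormSq S.g x (S.V x) := by
  have := (S.hg x (S.hWU hx)).dotProduct_mulVec_pos (S.hV0 x hx)
  simpa [metricNormSq] using this

/-- `|V|_g`: `C²` and positive on `W`. [folklore] -/
theorem cd_norm : ContDiffOn ℝ 2 (fun x => Real.sqrt (metricNormSq S.g x (S.V x))) S.W :=
  S.cd_normSq.sqrt fun _ hx => (S.normSq_pos hx).ne'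

/-- Components of the unit field: `C²` on `W`. [folklore] -/
theorem cd_u (a : Fin d) : ContDiffOn ℝ 2 (fun x => unitField S.g S.V x a) S.W := by
  have : (fun x => unitField S.g S.V x a) =
      fun x => (Real.sqrt (metricNormSq S.g x (S.V x)))⁻¹ * S.V x a := by
    funext x
    simp [unitField]
  rw [this]
  exact (S.cd_norm.inv fun _ hx => (Real.sqrt_pos.mpr (S.normSq_pos hx)).ne').mul (S.cd_V a)

/-- Components of the lowered unit field: `C²` on `W`. [folklore] -/
theorem cd_uL (a : Fin d) : ContDiffOn ℝ 2 (fun x => (S.g x *ᵥ unitField S.g S.V x) a) S.W := by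
  simp only [Matrix.mulVec, dotProduct]
  exact ContDiffOn.sum fun b _ => (((S.cd_g a b).mono S.hWU).of_le (by norm_num)).mul (S.cd_u b)

/-- First partials of the unit field: `C¹` on `W`. [folklore] -/
theorem cd_du (k j : Fin d) : ContDiffOn ℝ 1 (coordPartial k fun x => unitField S.g S.V x j) S.W :=
  contDiffOn_coordPartial_of_succ_le k (S.cd_u j) S.hW (by norm_num)

/-- The covariant derivative of the unit field: `C¹` on `W`. [folklore] -/
theorem cd_N (a k : Fin d) : ContDiffOn ℝ 1 (fun x => covDerivUnitField S.g S.V x a k) S.W := by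
  unfold covDerivUnitField
  refine ContDiffOn.sum fun j _ => (((S.cd_g a j).mono S.hWU).of_le (by norm_num)).mul ?_
  refine (S.cd_du k j).add (ContDiffOn.sum fun l _ => ?_)
  exact (((S.cd_Γ j k l).mono S.hWU).of_le (by norm_num)).mul ((S.cd_u l).of_le (by norm_num))

/-- `det g`: `C³` on `U`. [folklore] -/
theorem cd_det : ContDiffOn ℝ 3 (fun x => (S.g x).det) S.U := contDiffOn_det S.hgs

/-- `ρ = (√det g)⁻¹`: `C³` on `U`. [folklore] -/
theorem cd_ρ : ContDiffOn ℝ 3 (fun x => (Real.sqrt (S.g x).det)⁻¹) S.U :=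
  (S.cd_det.sqrt fun _ hx => (S.det_pos hx).ne').inv fun _ hx =>
    (Real.sqrt_pos.mpr (S.det_pos hx)).ne'

/-! #### Jets at a point, in matrix form -/

/-- `(∂ₖg)(x)` as a matrix. [folklore] -/
def dgM (k : Fin d) (x : Fin d → ℝ) : Matrix (Fin d) (Fin d) ℝ :=
  Matrix.of fun a b => coordPartial k (fun y => S.g y a b) x

/-- `Γₖ(x) = (Γᵃₖ_b(x))_{ab}` as a matrix. [folklore] -/
def GM (k : Fin d) (x : Fin d → ℝ) : Matrix (Fin d) (Fin d) ℝ :=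
  Matrix.of fun a b => coordChristoffel S.g x a k b

/-- `(∂ₘΓₖ)(x)` as a matrix. [folklore] -/
def AM (m k : Fin d) (x : Fin d → ℝ) : Matrix (Fin d) (Fin d) ℝ :=
  Matrix.of fun a b => coordPartial m (fun y => coordChristoffel S.g y a k b) x

/-- The curvature endomorphism `R_{kl}(x) = (Rᵃ_{bkl}(x))_{ab}` as a matrix. [folklore] -/
def RupM (k l : Fin d) (x : Fin d → ℝ) : Matrix (Fin d) (Fin d) ℝ :=
  Matrix.of fun a b => coordRiemannUp S.g x a b k l

/-- Entries of `dgM`. [folklore] -/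
@[simp] theorem dgM_apply (k : Fin d) (x : Fin d → ℝ) (a b : Fin d) :
    S.dgM k x a b = coordPartial k (fun y => S.g y a b) x := rfl
/-- Entries of `GM`. [folklore] -/
@[simp] theorem GM_apply (k : Fin d) (x : Fin d → ℝ) (a b : Fin d) :
    S.GM k x a b = coordChristoffel S.g x a k b := rfl
/-- Entries of `AM`. [folklore] -/
@[simp] theorem AM_apply (m k : Fin d) (x : Fin d → ℝ) (a b : Fin d) :
    S.AM m k x a b = coordPartial m (fun y => coordChristoffel S.g y a k b) x := rfl
/-- Entries of `RupM`. [folklore] -/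
@[simp] theorem RupM_apply (k l : Fin d) (x : Fin d → ℝ) (a b : Fin d) :
    S.RupM k l x a b = coordRiemannUp S.g x a b k l := rfl

/-- The curvature endomorphism in matrix form: `R_{kl} = ∂ₖΓₗ - ∂ₗΓₖ + ΓₖΓₗ - ΓₗΓₖ`.
[cite: Lee2018, Prop. 7.4] -/
theorem RupM_eq (k l : Fin d) (x : Fin d → ℝ) :
    S.RupM k l x = S.AM k l x - S.AM l k x + S.GM k x * S.GM l x - S.GM l x * S.GM k x := by
  ext a b
  simp only [RupM_apply, coordRiemannUp, Matrix.sub_apply, Matrix.add_apply, Matrix.mul_apply,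
    AM_apply, GM_apply, Finset.sum_sub_distrib]
  ring

/-- Symmetry of the first partials of `g` in the matrix indices. [folklore] -/
theorem dg_symm {x : Fin d → ℝ} (hx : x ∈ S.U) (k a b : Fin d) :
    coordPartial k (fun y => S.g y b a) x = coordPartial k (fun y => S.g y a b) x :=
  coordPartial_congr k (S.g_symm_eventually hx a b)

/-- `(∂ₖg)ᵀ = ∂ₖg`. [folklore] -/
theorem dgM_transpose {x : Fin d → ℝ} (hx : x ∈ S.U) (k : Fin d) : (S.dgM k x)ᵀ = S.dgM k x := by
  ext a b
  simp [S.dg_symm hx k a b]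

/-- The **Christoffel symbols of the first kind**:
`(g Γₖ)_{ab} = ½(∂ₖg_{ab} + ∂_b g_{ka} - ∂ₐg_{kb})`. [cite: Lee2018, (5.10)] -/
theorem g_mul_GM_apply {x : Fin d → ℝ} (hx : x ∈ S.U) (k a b : Fin d) :
    (S.g x * S.GM k x) a b = 2⁻¹ * (coordPartial k (fun y => S.g y a b) x +
      coordPartial b (fun y => S.g y k a) x - coordPartial a (fun y => S.g y k b) x) := by
  set X : Fin d → ℝ := fun l => coordPartial k (fun y => S.g y l b) x +
    coordPartial b (fun y => S.g y k l) x - coordPartial l (fun y => S.g y k b) x with hX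
  have h1 : (S.g x * S.GM k x) a b = 2⁻¹ * ∑ l, (S.g x * (S.g x)⁻¹) a l * X l := by
    simp only [Matrix.mul_apply, GM_apply, coordChristoffel, hX, Finset.mul_sum, Finset.sum_mul]
    rw [Finset.sum_comm]
    refine Finset.sum_congr rfl fun l _ => Finset.sum_congr rfl fun j _ => ?_
    ring
  rw [h1, S.mul_inv hx]
  simp only [Matrix.one_apply, ite_mul, one_mul, zero_mul, Finset.sum_ite_eq, Finset.mem_univ,
    if_true, hX]

/-- **Metric compatibility** in matrix form: `∂ₖg = g Γₖ + Γₖᵀ g` on `U`.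
[cite: Lee2018, Prop. 5.5] -/
theorem metric_compat {x : Fin d → ℝ} (hx : x ∈ S.U) (k : Fin d) :
    S.dgM k x = S.g x * S.GM k x + (S.GM k x)ᵀ * S.g x := by
  have hT : (S.GM k x)ᵀ * S.g x = (S.g x * S.GM k x)ᵀ := by
    rw [Matrix.transpose_mul]
    congr 1
    exact (Matrix.ext fun a b => S.g_symm hx a b).symm
  rw [hT]
  ext a b
  rw [Matrix.add_apply, Matrix.transpose_apply, S.g_mul_GM_apply hx, S.g_mul_GM_apply hx, dgM_apply,
    S.dg_symm hx k a b]
  ring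

/-! #### The unit field: `|u| = 1` and its consequences (A1), (A2), (S1) -/

/-- The unit field has unit length: `metricNormSq g (u) = 1` on `W`. [folklore] -/
theorem normSq_unitField {x : Fin d → ℝ} (hx : x ∈ S.W) :
    metricNormSq S.g x (unitField S.g S.V x) = 1 := by
  have hn := S.normSq_pos hx
  unfold unitField
  simp only [metricNormSq, Matrix.mulVec_smul, dotProduct_smul, smul_dotProduct, smul_eq_mul] at hn ⊢
  rw [← mul_assoc, ← _root_.mul_inv_rev, Real.mul_self_sqrt hn.le, inv_mul_cancel₀ hn.ne']

/-! #### Differentiability at points -/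

/-- Entries of `g` are differentiable at points of `U`. [folklore] -/
theorem diff_g {x : Fin d → ℝ} (hx : x ∈ S.U) (a b : Fin d) :
    DifferentiableAt ℝ (fun y => S.g y a b) x :=
  differentiableAt_of_contDiffOn (S.cd_g a b) S.hU hx (by norm_num)

/-- First partials of `g` are differentiable at points of `U`. [folklore] -/
theorem diff_dg {x : Fin d → ℝ} (hx : x ∈ S.U) (k a b : Fin d) :
    DifferentiableAt ℝ (coordPartial k fun y => S.g y a b) x :=
  differentiableAt_of_contDiffOn (S.cd_dg k a b) S.hU hx (by norm_num)

/-- Christoffel symbols are differentiable at points of `U`. [folklore] -/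
theorem diff_Γ {x : Fin d → ℝ} (hx : x ∈ S.U) (a k b : Fin d) :
    DifferentiableAt ℝ (fun y => coordChristoffel S.g y a k b) x :=
  differentiableAt_of_contDiffOn (S.cd_Γ a k b) S.hU hx (by norm_num)

/-- First partials of the Christoffel symbols are differentiable at points of `U`. [folklore] -/
theorem diff_dΓ {x : Fin d → ℝ} (hx : x ∈ S.U) (m a k b : Fin d) :
    DifferentiableAt ℝ (coordPartial m fun y => coordChristoffel S.g y a k b) x :=
  differentiableAt_of_contDiffOn (S.cd_dΓ m a k b) S.hU hx (by norm_num)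

/-- Components of the unit field are differentiable at points of `W`. [folklore] -/
theorem diff_u {x : Fin d → ℝ} (hx : x ∈ S.W) (j : Fin d) :
    DifferentiableAt ℝ (fun y => unitField S.g S.V y j) x :=
  differentiableAt_of_contDiffOn (S.cd_u j) S.hW hx (by norm_num)

/-- First partials of the unit field are differentiable at points of `W`. [folklore] -/
theorem diff_du {x : Fin d → ℝ} (hx : x ∈ S.W) (k j : Fin d) :
    DifferentiableAt ℝ (coordPartial k fun y => unitField S.g S.V y j) x :=
  differentiableAt_of_contDiffOn (S.cd_du k j) S.hW hx (by norm_num)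

/-! #### The unit field in vector form -/

/-- The vector of `k`-th partials of the unit field. [folklore] -/
def duV (k : Fin d) (x : Fin d → ℝ) : Fin d → ℝ := fun j => coordPartial k (fun y => unitField S.g S.V y j) x

/-- Entries of `duV`. [folklore] -/
@[simp] theorem duV_apply (k : Fin d) (x : Fin d → ℝ) (j : Fin d) :
    S.duV k x j = coordPartial k (fun y => unitField S.g S.V y j) x := rfl

/-- The covariant derivative of the unit field in vector form: `N_k = g (∂ₖu + Γₖ u)`.
[cite: Chern1944, (11)] -/
theorem N_eq_mulVec (x : Fin d → ℝ) (a k : Fin d) :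
    covDerivUnitField S.g S.V x a k =
      (S.g x *ᵥ (S.duV k x + S.GM k x *ᵥ unitField S.g S.V x)) a := by
  simp only [covDerivUnitField, Matrix.mulVec, dotProduct, Pi.add_apply, duV_apply, GM_apply]

/-- **(A1)** `vᵃ uₐ = |u|² = 1`. [folklore] -/
theorem A1 {x : Fin d → ℝ} (hx : x ∈ S.W) :
    ∑ a, unitField S.g S.V x a * (S.g x *ᵥ unitField S.g S.V x) a = 1 :=
  S.normSq_unitField hx

/-- **(S1)**, metric compatibility for the lowered unit field:
`∂ᵢuₐ = N_{ai} + Γᵇᵢₐ u_b`. [cite: Chern1945, (4)] -/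
theorem S1 {x : Fin d → ℝ} (hx : x ∈ S.W) (a i : Fin d) :
    coordPartial i (fun y => (S.g y *ᵥ unitField S.g S.V y) a) x =
      covDerivUnitField S.g S.V x a i +
        ∑ b, coordChristoffel S.g x b i a * (S.g x *ᵥ unitField S.g S.V x) b := by
  have hxU := S.hWU hx
  -- product rule
  have h1 : coordPartial i (fun y => (S.g y *ᵥ unitField S.g S.V y) a) x =
      (S.dgM i x *ᵥ unitField S.g S.V x + S.g x *ᵥ S.duV i x) a := by
    simp only [Matrix.mulVec, dotProduct, Pi.add_apply, dgM_apply, duV_apply,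
      ← Finset.sum_add_distrib]
    rw [coordPartial_sum]
    · refine Finset.sum_congr rfl fun b _ => ?_
      rw [coordPartial_mul _ (S.diff_g hxU a b) (S.diff_u hx b)]
    · intro b _
      exact (S.diff_g hxU a b).mul (S.diff_u hx b)
  rw [h1, S.metric_compat hxU, N_eq_mulVec]
  have h2 : ∑ b, coordChristoffel S.g x b i a * (S.g x *ᵥ unitField S.g S.V x) b =
      ((S.GM i x)ᵀ *ᵥ (S.g x *ᵥ unitField S.g S.V x)) a := by
    simp only [Matrix.mulVec, dotProduct, Matrix.transpose_apply, GM_apply]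
  rw [h2]
  simp only [Matrix.add_mulVec, Matrix.mulVec_add, ← Matrix.mulVec_mulVec, Pi.add_apply]
  ring

/-- Symmetric matrices: `v ⬝ (A w) = w ⬝ (A v)`. [folklore] -/
theorem dotProduct_mulVec_comm_of_symm {A : Matrix (Fin d) (Fin d) ℝ} (hA : Aᵀ = A)
    (v w : Fin d → ℝ) : v ⬝ᵥ (A *ᵥ w) = w ⬝ᵥ (A *ᵥ v) := by
  rw [Matrix.dotProduct_mulVec, ← Matrix.mulVec_transpose, hA, dotProduct_comm]

/-- **(A2)** `vᵃ N_{ak} = ½ ∂ₖ|u|² = 0`. [cite: Chern1945, (4)] -/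
theorem A2 {x : Fin d → ℝ} (hx : x ∈ S.W) (k : Fin d) :
    ∑ a, unitField S.g S.V x a * covDerivUnitField S.g S.V x a k = 0 := by
  have hxU := S.hWU hx
  have hgT : (S.g x)ᵀ = S.g x := Matrix.ext fun a b => S.g_symm hxU a b
  set u := unitField S.g S.V x with hu
  -- the derivative of the constant function `|u|² = 1` vanishes
  have h0 : coordPartial k (fun y => metricNormSq S.g y (unitField S.g S.V y)) x = 0 := by
    have : (fun y => metricNormSq S.g y (unitField S.g S.V y)) =ᶠ[𝓝 x] fun _ => (1 : ℝ) := by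
      filter_upwards [S.hW.mem_nhds hx] with y hy
      exact S.normSq_unitField hy
    rw [coordPartial_congr k this, coordPartial_const]
  -- expand it by the product rule
  have e : ∀ y, metricNormSq S.g y (unitField S.g S.V y) =
      ∑ a, ∑ b, unitField S.g S.V y a * (S.g y a b * unitField S.g S.V y b) := fun y => by
    simp only [metricNormSq, Matrix.mulVec, dotProduct, Finset.mul_sum]
  have h1 : coordPartial k (fun y => metricNormSq S.g y (unitField S.g S.V y)) x =
      S.duV k x ⬝ᵥ (S.g x *ᵥ u) + u ⬝ᵥ (S.dgM k x *ᵥ u) + u ⬝ᵥ (S.g x *ᵥ S.duV k x) := by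
    simp only [e]
    rw [coordPartial_sum]
    · simp only [dotProduct, Matrix.mulVec, duV_apply, dgM_apply, hu, Finset.mul_sum,
        ← Finset.sum_add_distrib]
      refine Finset.sum_congr rfl fun a _ => ?_
      rw [coordPartial_sum]
      · refine Finset.sum_congr rfl fun b _ => ?_
        rw [coordPartial_mul _ (S.diff_u hx a) ((S.diff_g hxU a b).fun_mul (S.diff_u hx b)),
          coordPartial_mul _ (S.diff_g hxU a b) (S.diff_u hx b)]
        ring
      · intro b _
        exact (S.diff_u hx a).fun_mul ((S.diff_g hxU a b).fun_mul (S.diff_u hx b))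
    · intro a _
      exact DifferentiableAt.fun_sum fun b _ =>
        (S.diff_u hx a).fun_mul ((S.diff_g hxU a b).fun_mul (S.diff_u hx b))
  -- rewrite `v·N` in vector form
  have h2 : ∑ a, u a * covDerivUnitField S.g S.V x a k =
      u ⬝ᵥ (S.g x *ᵥ S.duV k x) + u ⬝ᵥ (S.g x *ᵥ (S.GM k x *ᵥ u)) := by
    simp only [N_eq_mulVec, ← hu, Matrix.mulVec_add, dotProduct, Pi.add_apply, mul_add,
      Finset.sum_add_distrib]
  rw [h2]
  rw [h1, S.metric_compat hxU, Matrix.add_mulVec, dotProduct_add, ← Matrix.mulVec_mulVec,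
    ← Matrix.mulVec_mulVec, dotProduct_mulVec_comm_of_symm hgT (S.duV k x) u] at h0
  have h3 : u ⬝ᵥ ((S.GM k x)ᵀ *ᵥ (S.g x *ᵥ u)) = u ⬝ᵥ (S.g x *ᵥ (S.GM k x *ᵥ u)) := by
    rw [Matrix.dotProduct_mulVec u ((S.GM k x)ᵀ), ← Matrix.mulVec_transpose, Matrix.transpose_transpose,
      dotProduct_mulVec_comm_of_symm hgT]
  rw [h3] at h0
  linarith

/-! #### Metric compatibility at second order and the skew-symmetry of `R` (A3) -/

/-- Second partials of `g` as a matrix. [folklore] -/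
def SgM (l k : Fin d) (x : Fin d → ℝ) : Matrix (Fin d) (Fin d) ℝ :=
  Matrix.of fun a b => coordPartial l (coordPartial k fun y => S.g y a b) x

/-- Entries of `SgM`. [folklore] -/
@[simp] theorem SgM_apply (l k : Fin d) (x : Fin d → ℝ) (a b : Fin d) :
    S.SgM l k x a b = coordPartial l (coordPartial k fun y => S.g y a b) x := rfl

/-- Symmetry of the second partials of `g`. [folklore] -/
theorem SgM_symm {x : Fin d → ℝ} (hx : x ∈ S.U) (l k : Fin d) : S.SgM l k x = S.SgM k l x := by
  ext a b
  exact coordPartial_comm (((S.cd_g a b).contDiffAt (S.hU.mem_nhds hx)).of_le (by norm_num)) l k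

/-- **Differentiated metric compatibility**:
`∂ₗ∂ₖg = ∂ₗg Γₖ + g ∂ₗΓₖ + (∂ₗΓₖ)ᵀ g + Γₖᵀ ∂ₗg`. [folklore] -/
theorem dMC {x : Fin d → ℝ} (hx : x ∈ S.U) (l k : Fin d) :
    S.SgM l k x = S.dgM l x * S.GM k x + S.g x * S.AM l k x + (S.AM l k x)ᵀ * S.g x +
      (S.GM k x)ᵀ * S.dgM l x := by
  ext a b
  have hev : (coordPartial k fun y => S.g y a b) =ᶠ[𝓝 x] fun y =>
      ∑ j, S.g y a j * coordChristoffel S.g y j k b + ∑ j, coordChristoffel S.g y j k a * S.g y j b := by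
    filter_upwards [S.hU.mem_nhds hx] with y hy
    have := congrFun (congrFun (S.metric_compat hy k) a) b
    simpa [Matrix.mul_apply, Matrix.add_apply, Matrix.transpose_apply] using this
  rw [SgM_apply, coordPartial_congr l hev, coordPartial_add, coordPartial_sum, coordPartial_sum]
  · simp only [Matrix.add_apply, Matrix.mul_apply, Matrix.transpose_apply, dgM_apply, GM_apply,
      AM_apply, ← Finset.sum_add_distrib]
    refine Finset.sum_congr rfl fun j _ => ?_
    rw [coordPartial_mul _ (S.diff_g hx a j) (S.diff_Γ hx j k b),
      coordPartial_mul _ (S.diff_Γ hx j k a) (S.diff_g hx j b)]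
    ring
  · intro j _
    exact (S.diff_Γ hx j k a).fun_mul (S.diff_g hx j b)
  · intro j _
    exact (S.diff_g hx a j).fun_mul (S.diff_Γ hx j k b)
  · exact DifferentiableAt.fun_sum fun j _ => (S.diff_g hx a j).fun_mul (S.diff_Γ hx j k b)
  · exact DifferentiableAt.fun_sum fun j _ => (S.diff_Γ hx j k a).fun_mul (S.diff_g hx j b)

/-- The covariant curvature is a matrix product: `R_{abkl} = (g R_{kl})_{ab}`. [folklore] -/
theorem coordRiemann_eq_mul (x : Fin d → ℝ) (a b k l : Fin d) :
    coordRiemann S.g x a b k l = (S.g x * S.RupM k l x) a b := by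
  simp only [coordRiemann, Matrix.mul_apply, RupM_apply]

/-- **Metric compatibility at second order**: `g R_{kl} + (g R_{kl})ᵀ = 0`. [cite: Lee2018, Prop. 7.12] -/
theorem g_mul_RupM_add_transpose {x : Fin d → ℝ} (hx : x ∈ S.U) (k l : Fin d) :
    S.g x * S.RupM k l x + (S.g x * S.RupM k l x)ᵀ = 0 := by
  have hgT : (S.g x)ᵀ = S.g x := Matrix.ext fun a b => S.g_symm hx a b
  have h0 : S.dgM l x * S.GM k x + S.g x * S.AM l k x + (S.AM l k x)ᵀ * S.g x +
      (S.GM k x)ᵀ * S.dgM l x - (S.dgM k x * S.GM l x + S.g x * S.AM k l x + (S.AM k l x)ᵀ * S.g x +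
      (S.GM l x)ᵀ * S.dgM k x) = 0 := by
    rw [← S.dMC hx l k, ← S.dMC hx k l, S.SgM_symm hx l k, sub_self]
  rw [S.metric_compat hx k, S.metric_compat hx l] at h0
  rw [S.RupM_eq, Matrix.transpose_mul, hgT]
  simp only [Matrix.transpose_sub, Matrix.transpose_add, Matrix.transpose_mul]
  rw [← neg_eq_zero, ← h0]
  noncomm_ring

/-- **(A3)** the covariant Riemann tensor is skew in its first two indices. [cite: Lee2018, Prop. 7.12] -/
theorem A3 {x : Fin d → ℝ} (hx : x ∈ S.U) (a b k l : Fin d) :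
    coordRiemann S.g x a b k l = -coordRiemann S.g x b a k l := by
  have := congrFun (congrFun (S.g_mul_RupM_add_transpose hx k l) a) b
  rw [Matrix.add_apply, Matrix.transpose_apply, ← coordRiemann_eq_mul, ← coordRiemann_eq_mul,
    Matrix.zero_apply] at this
  linarith

/-! #### The structure equation for the unit field (S2) -/

/-- Second partials of the unit field as a vector. [folklore] -/
def dduV (i k : Fin d) (x : Fin d → ℝ) : Fin d → ℝ :=
  fun j => coordPartial i (coordPartial k fun y => unitField S.g S.V y j) x

/-- Entries of `dduV`. [folklore] -/
@[simp] theorem dduV_apply (i k : Fin d) (x : Fin d → ℝ) (j : Fin d) :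
    S.dduV i k x j = coordPartial i (coordPartial k fun y => unitField S.g S.V y j) x := rfl

/-- Symmetry of the second partials of the unit field. [folklore] -/
theorem dduV_symm {x : Fin d → ℝ} (hx : x ∈ S.W) (i k : Fin d) : S.dduV i k x = S.dduV k i x := by
  funext j
  exact coordPartial_comm ((S.cd_u j).contDiffAt (S.hW.mem_nhds hx)) i k

/-- The partials of `N_k` in vector form:
`∂ᵢN_k = ∂ᵢg (∂ₖu + Γₖu) + g (∂ᵢ∂ₖu + ∂ᵢΓₖ u + Γₖ ∂ᵢu)`. [folklore] -/
theorem dN_eq {x : Fin d → ℝ} (hx : x ∈ S.W) (i k a : Fin d) :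
    coordPartial i (fun y => covDerivUnitField S.g S.V y a k) x =
      (S.dgM i x *ᵥ (S.duV k x + S.GM k x *ᵥ unitField S.g S.V x) +
        S.g x *ᵥ (S.dduV i k x + S.AM i k x *ᵥ unitField S.g S.V x + S.GM k x *ᵥ S.duV i x)) a := by
  have hxU := S.hWU hx
  have hdw : ∀ j, DifferentiableAt ℝ (fun y => coordPartial k (fun y => unitField S.g S.V y j) y +
      ∑ l, coordChristoffel S.g y j k l * unitField S.g S.V y l) x := fun j =>
    (S.diff_du hx k j).fun_add (DifferentiableAt.fun_sum fun l _ =>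
      (S.diff_Γ hxU j k l).fun_mul (S.diff_u hx l))
  unfold covDerivUnitField
  rw [coordPartial_sum _ _ fun j _ => (S.diff_g hxU a j).fun_mul (hdw j)]
  simp only [Matrix.mulVec, dotProduct, Pi.add_apply, dgM_apply, duV_apply, dduV_apply, GM_apply,
    AM_apply, ← Finset.sum_add_distrib]
  refine Finset.sum_congr rfl fun j _ => ?_
  have hprod : ∀ l, coordPartial i (fun y => coordChristoffel S.g y j k l * unitField S.g S.V y l) x =
      coordPartial i (fun y => coordChristoffel S.g y j k l) x * unitField S.g S.V x l +
        coordChristoffel S.g x j k l * coordPartial i (fun y => unitField S.g S.V y l) x := fun l =>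
    coordPartial_mul _ (S.diff_Γ hxU j k l) (S.diff_u hx l)
  rw [coordPartial_mul _ (S.diff_g hxU a j) (hdw j), coordPartial_add _ (S.diff_du hx k j)
    (DifferentiableAt.fun_sum fun l _ => (S.diff_Γ hxU j k l).fun_mul (S.diff_u hx l)),
    coordPartial_sum _ _ fun l _ => (S.diff_Γ hxU j k l).fun_mul (S.diff_u hx l)]
  simp only [hprod, mul_add, Finset.mul_sum, Finset.sum_add_distrib]
  ring

/-- **(S2)**, the structure equation `∇η = Ω·u` for the unit field in coordinates:
`∂ᵢN_{ak} - ∂ₖN_{ai} = R_{acik}vᶜ + Γᵇᵢₐ N_{bk} - Γᵇₖₐ N_{bi}`. [cite: Chern1945, (5)] -/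
theorem S2 {x : Fin d → ℝ} (hx : x ∈ S.W) (a i k : Fin d) :
    coordPartial i (fun y => covDerivUnitField S.g S.V y a k) x -
        coordPartial k (fun y => covDerivUnitField S.g S.V y a i) x =
      (∑ c, coordRiemann S.g x a c i k * unitField S.g S.V x c) +
        ∑ b, (coordChristoffel S.g x b i a * covDerivUnitField S.g S.V x b k -
          coordChristoffel S.g x b k a * covDerivUnitField S.g S.V x b i) := by
  have hxU := S.hWU hx
  set u := unitField S.g S.V x with hu
  -- both sides in vector form
  have hR : ∑ c, coordRiemann S.g x a c i k * u c = (S.g x *ᵥ (S.RupM i k x *ᵥ u)) a := by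
    simp only [coordRiemann_eq_mul, Matrix.mul_apply, Matrix.mulVec, dotProduct, Finset.sum_mul,
      Finset.mul_sum, mul_assoc]
    exact Finset.sum_comm
  have hN : ∀ k, (fun b => covDerivUnitField S.g S.V x b k) =
      S.g x *ᵥ (S.duV k x + S.GM k x *ᵥ u) := fun k => funext fun b => S.N_eq_mulVec x b k
  have hΓ : ∑ b, (coordChristoffel S.g x b i a * covDerivUnitField S.g S.V x b k -
      coordChristoffel S.g x b k a * covDerivUnitField S.g S.V x b i) =
      ((S.GM i x)ᵀ *ᵥ (S.g x *ᵥ (S.duV k x + S.GM k x *ᵥ u)) -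
        (S.GM k x)ᵀ *ᵥ (S.g x *ᵥ (S.duV i x + S.GM i x *ᵥ u))) a := by
    rw [← hN k, ← hN i]
    simp only [Pi.sub_apply, Matrix.mulVec, dotProduct, Matrix.transpose_apply, GM_apply,
      Finset.sum_sub_distrib]
  rw [hR, hΓ, S.dN_eq hx i k a, S.dN_eq hx k i a, ← hu, S.metric_compat hxU i, S.metric_compat hxU k,
    S.dduV_symm hx k i, S.RupM_eq]
  simp only [Matrix.add_mulVec, Matrix.sub_mulVec, Matrix.mulVec_add, Matrix.mulVec_sub,
    ← Matrix.mulVec_mulVec, Pi.add_apply, Pi.sub_apply]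
  ring

/-! #### The second Bianchi identity (S3) -/

/-- First partials of the curvature endomorphism as a matrix. [folklore] -/
def dRupM (m k l : Fin d) (x : Fin d → ℝ) : Matrix (Fin d) (Fin d) ℝ :=
  Matrix.of fun a b => coordPartial m (fun y => coordRiemannUp S.g y a b k l) x

/-- Entries of `dRupM`. [folklore] -/
@[simp] theorem dRupM_apply (m k l : Fin d) (x : Fin d → ℝ) (a b : Fin d) :
    S.dRupM m k l x a b = coordPartial m (fun y => coordRiemannUp S.g y a b k l) x := rfl

/-- Second partials of the Christoffel matrices. [folklore] -/
def SΓM (m k l : Fin d) (x : Fin d → ℝ) : Matrix (Fin d) (Fin d) ℝ :=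
  Matrix.of fun a b => coordPartial m (coordPartial k fun y => coordChristoffel S.g y a l b) x

/-- Entries of `SΓM`. [folklore] -/
@[simp] theorem SΓM_apply (m k l : Fin d) (x : Fin d → ℝ) (a b : Fin d) :
    S.SΓM m k l x a b = coordPartial m (coordPartial k fun y => coordChristoffel S.g y a l b) x := rfl

/-- Symmetry of the second partials of the Christoffel symbols. [folklore] -/
theorem SΓM_symm {x : Fin d → ℝ} (hx : x ∈ S.U) (m k l : Fin d) : S.SΓM m k l x = S.SΓM k m l x := by
  ext a b
  exact coordPartial_comm ((S.cd_Γ a l b).contDiffAt (S.hU.mem_nhds hx)) m k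

/-- The partials of the curvature endomorphism:
`∂ₘR_{kl} = ∂ₘ∂ₖΓₗ - ∂ₘ∂ₗΓₖ + ∂ₘΓₖ Γₗ + Γₖ ∂ₘΓₗ - ∂ₘΓₗ Γₖ - Γₗ ∂ₘΓₖ`. [folklore] -/
theorem dRupM_eq {x : Fin d → ℝ} (hx : x ∈ S.U) (m k l : Fin d) :
    S.dRupM m k l x = S.SΓM m k l x - S.SΓM m l k x + (S.AM m k x * S.GM l x + S.GM k x * S.AM m l x) -
      (S.AM m l x * S.GM k x + S.GM l x * S.AM m k x) := by
  ext a b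
  simp only [dRupM_apply, Matrix.sub_apply, Matrix.add_apply, Matrix.mul_apply, SΓM_apply, AM_apply,
    GM_apply]
  unfold coordRiemannUp
  have hd1 : ∀ e, DifferentiableAt ℝ (fun y => coordChristoffel S.g y a k e * coordChristoffel S.g y e l b) x :=
    fun e => (S.diff_Γ hx a k e).fun_mul (S.diff_Γ hx e l b)
  have hd2 : ∀ e, DifferentiableAt ℝ (fun y => coordChristoffel S.g y a l e * coordChristoffel S.g y e k b) x :=
    fun e => (S.diff_Γ hx a l e).fun_mul (S.diff_Γ hx e k b)
  have hAB : DifferentiableAt ℝ (fun y => coordPartial k (fun y => coordChristoffel S.g y a l b) y -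
      coordPartial l (fun y => coordChristoffel S.g y a k b) y) x :=
    (S.diff_dΓ hx k a l b).fun_sub (S.diff_dΓ hx l a k b)
  have hsum : DifferentiableAt ℝ (fun y => ∑ e, (coordChristoffel S.g y a k e * coordChristoffel S.g y e l b -
      coordChristoffel S.g y a l e * coordChristoffel S.g y e k b)) x :=
    DifferentiableAt.fun_sum fun e _ => (hd1 e).fun_sub (hd2 e)
  rw [coordPartial_add _ hAB hsum, coordPartial_sub _ (S.diff_dΓ hx k a l b) (S.diff_dΓ hx l a k b),
    coordPartial_sum _ _ fun e _ => (hd1 e).fun_sub (hd2 e)]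
  have he : ∀ e, coordPartial m (fun y => coordChristoffel S.g y a k e * coordChristoffel S.g y e l b -
      coordChristoffel S.g y a l e * coordChristoffel S.g y e k b) x =
      (coordPartial m (fun y => coordChristoffel S.g y a k e) x * coordChristoffel S.g x e l b +
        coordChristoffel S.g x a k e * coordPartial m (fun y => coordChristoffel S.g y e l b) x) -
      (coordPartial m (fun y => coordChristoffel S.g y a l e) x * coordChristoffel S.g x e k b +
        coordChristoffel S.g x a l e * coordPartial m (fun y => coordChristoffel S.g y e k b) x) := by
    intro e
    rw [coordPartial_sub _ (hd1 e) (hd2 e), coordPartial_mul _ (S.diff_Γ hx a k e) (S.diff_Γ hx e l b),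
      coordPartial_mul _ (S.diff_Γ hx a l e) (S.diff_Γ hx e k b)]
  simp only [he, Finset.sum_sub_distrib, Finset.sum_add_distrib]
  ring

/-- The cyclic (second Bianchi) identity in a noncommutative ring: with
`R_{kl} = A_{kl} - A_{lk} + G_kG_l - G_lG_k`,
`∂ₘR_{kl} = S_{mkl} - S_{mlk} + A_{mk}G_l + G_kA_{ml} - A_{ml}G_k - G_lA_{mk}` and `S` symmetric in its
first two indices, the cyclic sum of `GₘR_{kl} + ∂ₘR_{kl} - R_{kl}Gₘ` vanishes. [folklore] -/
theorem cyclic_bianchi_ring {A : Type*} [Ring A] (G : Fin d → A) (Am : Fin d → Fin d → A)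
    (Sm : Fin d → Fin d → Fin d → A) (hS : ∀ m k l, Sm m k l = Sm k m l) (m k l : Fin d) :
    let R := fun k l => Am k l - Am l k + G k * G l - G l * G k
    let dR := fun m k l => Sm m k l - Sm m l k + (Am m k * G l + G k * Am m l) -
      (Am m l * G k + G l * Am m k)
    (G m * R k l + dR m k l - R k l * G m) + (G k * R l m + dR k l m - R l m * G k) +
      (G l * R m k + dR l m k - R m k * G l) = 0 := by
  intro R dR
  simp only [R, dR]
  rw [hS k m l, hS l k m, hS m l k]
  noncomm_ring

/-- **(S3)** the second Bianchi identity for the covariant curvature, in the form consumed by the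
algebraic core: the cyclic sums of `bianchiC` vanish. [cite: Lee2018, Prop. 7.13] -/
theorem S3 {x : Fin d → ℝ} (hx : x ∈ S.U) (a b m k l : Fin d) :
    Fock.bianchiC (coordRiemann S.g x) (fun e m a => coordChristoffel S.g x e m a)
        (fun a b k l m => coordPartial m (fun y => coordRiemann S.g y a b k l) x) a b m k l +
      Fock.bianchiC (coordRiemann S.g x) (fun e m a => coordChristoffel S.g x e m a)
        (fun a b k l m => coordPartial m (fun y => coordRiemann S.g y a b k l) x) a b k l m +
      Fock.bianchiC (coordRiemann S.g x) (fun e m a => coordChristoffel S.g x e m a)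
        (fun a b k l m => coordPartial m (fun y => coordRiemann S.g y a b k l) x) a b l m k = 0 := by
  -- `bianchiC (m,k,l) = (g (Gₘ R_{kl} + ∂ₘR_{kl} - R_{kl} Gₘ))_{ab}`
  have key : ∀ m k l : Fin d, Fock.bianchiC (coordRiemann S.g x) (fun e m a => coordChristoffel S.g x e m a)
      (fun a b k l m => coordPartial m (fun y => coordRiemann S.g y a b k l) x) a b m k l =
      (S.g x * (S.GM m x * S.RupM k l x + S.dRupM m k l x - S.RupM k l x * S.GM m x)) a b := by
    intro m k l
    -- the derivative of `R_{abkl} = ∑_f g_{af} Rᶠ_{bkl}`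
    have hd : coordPartial m (fun y => coordRiemann S.g y a b k l) x =
        (S.dgM m x * S.RupM k l x + S.g x * S.dRupM m k l x) a b := by
      unfold coordRiemann
      rw [coordPartial_sum _ _ fun f _ => (S.diff_g hx a f).fun_mul
        (differentiableAt_of_contDiffOn (S.cd_Rup f b k l) S.hU hx (by norm_num))]
      simp only [Matrix.add_apply, Matrix.mul_apply, dgM_apply, RupM_apply, dRupM_apply,
        ← Finset.sum_add_distrib]
      refine Finset.sum_congr rfl fun f _ => ?_
      rw [coordPartial_mul _ (S.diff_g hx a f)
        (differentiableAt_of_contDiffOn (S.cd_Rup f b k l) S.hU hx (by norm_num))]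
    set L : Matrix (Fin d) (Fin d) ℝ := Matrix.of fun e f => coordRiemann S.g x e f k l with hL
    have hLg : L = S.g x * S.RupM k l x := Matrix.ext fun e f => S.coordRiemann_eq_mul x e f k l
    have e1 : ∑ e, (coordRiemann S.g x e b k l * coordChristoffel S.g x e m a +
        coordRiemann S.g x a e k l * coordChristoffel S.g x e m b) =
        ((S.GM m x)ᵀ * L + L * S.GM m x) a b := by
      simp only [Matrix.add_apply, Matrix.mul_apply, Matrix.transpose_apply, GM_apply, hL, Matrix.of_apply,
        Finset.sum_add_distrib]
      congr 1
      exact Finset.sum_congr rfl fun e _ => mul_comm _ _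
    have hmat : S.dgM m x * S.RupM k l x + S.g x * S.dRupM m k l x -
        ((S.GM m x)ᵀ * (S.g x * S.RupM k l x) + S.g x * S.RupM k l x * S.GM m x) =
        S.g x * (S.GM m x * S.RupM k l x + S.dRupM m k l x - S.RupM k l x * S.GM m x) := by
      rw [S.metric_compat hx m]
      noncomm_ring
    rw [Fock.bianchiC, hd, e1, hLg, ← Matrix.sub_apply, hmat]
  have hc := cyclic_bianchi_ring (fun k => S.GM k x) (fun m k => S.AM m k x) (fun m k l => S.SΓM m k l x)
    (S.SΓM_symm hx) m k l
  dsimp only at hc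
  rw [key, key, key, ← Matrix.add_apply, ← Matrix.add_apply, ← Matrix.mul_add, ← Matrix.mul_add,
    S.RupM_eq, S.RupM_eq, S.RupM_eq, S.dRupM_eq hx, S.dRupM_eq hx, S.dRupM_eq hx, hc, Matrix.mul_zero,
    Matrix.zero_apply]

/-! #### Jacobi's formula and (S4) -/

/-- **Jacobi's formula**: `∂ₖ det g = det g · tr(g⁻¹ ∂ₖg)`. [folklore] -/
theorem coordPartial_det {x : Fin d → ℝ} (hx : x ∈ S.U) (k : Fin d) :
    coordPartial k (fun y => (S.g y).det) x =
      (S.g x).det * ∑ a, ∑ l, (S.g x)⁻¹ a l * coordPartial k (fun y => S.g y l a) x := by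
  have hdet : (S.g x).det ≠ 0 := (S.det_pos hx).ne'
  -- Leibniz expansion and the product rule
  have e : (fun y => (S.g y).det) = fun y => ∑ σ : Equiv.Perm (Fin d),
      ((Equiv.Perm.sign σ : ℤ) : ℝ) * ∏ i, S.g y (σ i) i := funext fun y => Matrix.det_apply' _
  have hp : ∀ σ : Equiv.Perm (Fin d), HasFDerivAt (fun y => ∏ i, S.g y (σ i) i)
      (∑ i, (∏ j ∈ univ.erase i, S.g x (σ j) j) • fderiv ℝ (fun y => S.g y (σ i) i) x) x :=
    fun σ => HasFDerivAt.finsetProd fun i _ => (S.diff_g hx (σ i) i).hasFDerivAt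
  have h1 : coordPartial k (fun y => (S.g y).det) x = ∑ σ : Equiv.Perm (Fin d),
      ((Equiv.Perm.sign σ : ℤ) : ℝ) * ∑ i, (∏ j ∈ univ.erase i, S.g x (σ j) j) *
        coordPartial k (fun y => S.g y (σ i) i) x := by
    rw [e, coordPartial_sum _ _ fun σ _ => (hp σ).differentiableAt.const_mul _]
    refine Finset.sum_congr rfl fun σ _ => ?_
    rw [coordPartial_const_mul _ (hp σ).differentiableAt, coordPartial, (hp σ).fderiv]
    simp only [FunLike.coe_sum, Finset.sum_apply, FunLike.coe_smul, Pi.smul_apply, smul_eq_mul,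
      coordPartial]
  -- the column-replacement determinants
  have h2 : ∀ i : Fin d, ((S.g x).updateCol i fun a => coordPartial k (fun y => S.g y a i) x).det =
      ∑ σ : Equiv.Perm (Fin d), ((Equiv.Perm.sign σ : ℤ) : ℝ) *
        ((∏ j ∈ univ.erase i, S.g x (σ j) j) * coordPartial k (fun y => S.g y (σ i) i) x) := by
    intro i
    rw [Matrix.det_apply']
    refine Finset.sum_congr rfl fun σ _ => ?_
    congr 1
    rw [← Finset.mul_prod_erase _ _ (Finset.mem_univ i), Matrix.updateCol_self, mul_comm]
    congr 1
    exact Finset.prod_congr rfl fun j hj => by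
      rw [Matrix.updateCol_ne (Finset.ne_of_mem_erase hj)]
  have h3 : coordPartial k (fun y => (S.g y).det) x =
      ∑ i, ((S.g x).updateCol i fun a => coordPartial k (fun y => S.g y a i) x).det := by
    rw [h1]
    simp only [h2, Finset.mul_sum]
    exact Finset.sum_comm
  -- Cramer / adjugate
  have hadj : (S.g x).adjugate = (S.g x).det • (S.g x)⁻¹ := by
    rw [Matrix.inv_def, Ring.inverse_eq_inv', smul_smul, mul_inv_cancel₀ hdet, one_smul]
  rw [h3, Finset.mul_sum]
  refine Finset.sum_congr rfl fun i _ => ?_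
  rw [← Matrix.cramer_apply, Matrix.cramer_eq_adjugate_mulVec, hadj, Matrix.smul_mulVec,
    Pi.smul_apply, smul_eq_mul, Matrix.mulVec, dotProduct]

/-- The trace of the Christoffel symbols: `∑ₐ Γᵃₖₐ = ½ tr(g⁻¹∂ₖg)`. [folklore] -/
theorem sum_Γ_diag {x : Fin d → ℝ} (hx : x ∈ S.U) (k : Fin d) :
    ∑ a, coordChristoffel S.g x a k a =
      2⁻¹ * ∑ a, ∑ l, (S.g x)⁻¹ a l * coordPartial k (fun y => S.g y l a) x := by
  have hT : ∑ a, ∑ l, (S.g x)⁻¹ a l * coordPartial a (fun y => S.g y k l) x =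
      ∑ a, ∑ l, (S.g x)⁻¹ a l * coordPartial l (fun y => S.g y k a) x := by
    conv_rhs => rw [Finset.sum_comm]
    exact Finset.sum_congr rfl fun a _ => Finset.sum_congr rfl fun l _ => by rw [S.ginv_symm hx a l]
  simp only [coordChristoffel, ← Finset.mul_sum, mul_add, mul_sub, Finset.sum_add_distrib,
    Finset.sum_sub_distrib]
  rw [hT]
  ring

/-- **(S4)** the density factor: `∂ₖ (√det g)⁻¹ = -(√det g)⁻¹ ∑ₐ Γᵃₖₐ`. [folklore] -/
theorem S4 {x : Fin d → ℝ} (hx : x ∈ S.U) (k : Fin d) :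
    coordPartial k (fun y => (Real.sqrt (S.g y).det)⁻¹) x =
      -(Real.sqrt (S.g x).det)⁻¹ * ∑ a, coordChristoffel S.g x a k a := by
  have hdet := S.det_pos hx
  have hs : Real.sqrt (S.g x).det ≠ 0 := (Real.sqrt_pos.mpr hdet).ne'
  have hd : DifferentiableAt ℝ (fun y => (S.g y).det) x :=
    differentiableAt_of_contDiffOn S.cd_det S.hU hx (by norm_num)
  rw [coordPartial_inv _ (hd.sqrt hdet.ne') hs, coordPartial_sqrt _ hd hdet.ne', S.coordPartial_det hx,
    S.sum_Γ_diag hx, Real.sq_sqrt hdet.le]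
  field_simp

end ChernSetting

/-! ### The derivative of the transgression sums (hδT)

We differentiate `y ↦ Tₖ(i)(y) = tgSum (u(y), R(y), N(y))` by the chain rule through the space of
coefficient arrays; the derivative of the polynomial `tgSum` along the direction of the derivative
arrays is read off from the perturbation expansion `Fock.top_θ_perturb` (a polynomial identity in
one real variable), so no operator-valued calculus is needed. -/

section ArrayCalculus

/-- The space of coefficient arrays `(u, (R, N))`. [folklore] -/
abbrev Arr (d : ℕ) : Type :=
  (Fin d → ℝ) × ((Fin d → Fin d → Fin d → Fin d → ℝ) × (Fin d → Fin d → ℝ))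

/-- Finite products of differentiable real functions are differentiable. [folklore] -/
theorem differentiableAt_finsetProd' {E : Type*} [NormedAddCommGroup E] [NormedSpace ℝ E]
    {ι : Type*} {u : Finset ι} {f : ι → E → ℝ} {x : E} (h : ∀ i ∈ u, DifferentiableAt ℝ (f i) x) :
    DifferentiableAt ℝ (fun y => ∏ i ∈ u, f i y) x := by
  classical
  exact (HasFDerivAt.finsetProd fun i hi => (h i hi).hasFDerivAt).differentiableAt

/-- The transgression sum is a differentiable (polynomial) function of the coefficient arrays.
[folklore] -/
theorem differentiable_tgSum (k : Fin (d / 2)) (i : Fin d) :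
    Differentiable ℝ fun p : Arr d => Fock.tgSum p.1 p.2.1 p.2.2 k i := by
  intro p
  unfold Fock.tgSum
  refine DifferentiableAt.fun_sum fun σ _ => DifferentiableAt.fun_sum fun τ _ => ?_
  split_ifs
  · refine (((differentiableAt_const _).mul ?_).mul ?_).mul ?_
    · fun_prop
    · exact differentiableAt_finsetProd' fun m _ => by fun_prop
    · exact differentiableAt_finsetProd' fun s _ => by fun_prop
  · exact differentiableAt_const _

/-- The derivative at `0` of a real polynomial written as `A₀ + t A₁ + t² P(t)`. [folklore] -/
theorem hasDerivAt_quadratic_expansion (A₀ A₁ : ℝ) (b : ℕ → ℝ) (n₀ : ℕ) :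
    HasDerivAt (fun t : ℝ => A₀ + t * A₁ + t ^ 2 * ∑ r ∈ Finset.range n₀, t ^ r * b r) A₁ 0 := by
  have h1 : HasDerivAt (fun t : ℝ => t * A₁) A₁ 0 := by
    simpa using (hasDerivAt_id (0 : ℝ)).mul_const A₁
  have hs : HasDerivAt (fun t : ℝ => ∑ r ∈ Finset.range n₀, t ^ r * b r)
      (∑ r ∈ Finset.range n₀, ((r : ℝ) * (0 : ℝ) ^ (r - 1)) * b r) 0 :=
    HasDerivAt.fun_sum fun r _ => (hasDerivAt_pow r (0 : ℝ)).mul_const (b r)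
  have h2 : HasDerivAt (fun t : ℝ => t ^ 2 * ∑ r ∈ Finset.range n₀, t ^ r * b r) 0 0 := by
    have := (hasDerivAt_pow 2 (0 : ℝ)).fun_mul hs
    simpa using this
  simpa using ((hasDerivAt_const (0 : ℝ) A₀).fun_add h1).fun_add h2

namespace ChernSetting

variable (S : ChernSetting d)

/-- The coefficient map `y ↦ (u(y), (R(y), N(y)))`. [folklore] -/
def coeffMap (y : Fin d → ℝ) : Arr d :=
  (fun a => (S.g y *ᵥ unitField S.g S.V y) a,
    (fun a b k l => coordRiemann S.g y a b k l, fun a k => covDerivUnitField S.g S.V y a k))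

/-- The coefficient map is differentiable on `W`, with the expected partial derivatives.
[folklore] -/
theorem hasFDerivAt_coeffMap {x : Fin d → ℝ} (hx : x ∈ S.W) :
    ∃ D : (Fin d → ℝ) →L[ℝ] Arr d, HasFDerivAt S.coeffMap D x ∧ ∀ i : Fin d, D (Pi.single i 1) =
      (fun a => coordPartial i (fun y => (S.g y *ᵥ unitField S.g S.V y) a) x,
        (fun a b k l => coordPartial i (fun y => coordRiemann S.g y a b k l) x,
          fun a k => coordPartial i (fun y => covDerivUnitField S.g S.V y a k) x)) := by
  have hxU := S.hWU hx
  have hu : ∀ a, HasFDerivAt (fun y => (S.g y *ᵥ unitField S.g S.V y) a)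
      (fderiv ℝ (fun y => (S.g y *ᵥ unitField S.g S.V y) a) x) x := fun a =>
    (differentiableAt_of_contDiffOn (S.cd_uL a) S.hW hx (by norm_num)).hasFDerivAt
  have hR : ∀ a b k l, HasFDerivAt (fun y => coordRiemann S.g y a b k l)
      (fderiv ℝ (fun y => coordRiemann S.g y a b k l) x) x := fun a b k l =>
    (differentiableAt_of_contDiffOn (S.cd_R a b k l) S.hU hxU (by norm_num)).hasFDerivAt
  have hN : ∀ a k, HasFDerivAt (fun y => covDerivUnitField S.g S.V y a k)
      (fderiv ℝ (fun y => covDerivUnitField S.g S.V y a k) x) x := fun a k =>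
    (differentiableAt_of_contDiffOn (S.cd_N a k) S.hW hx (by norm_num)).hasFDerivAt
  refine ⟨_, (hasFDerivAt_pi.mpr hu).prodMk ((hasFDerivAt_pi.mpr fun a => hasFDerivAt_pi.mpr fun b =>
    hasFDerivAt_pi.mpr fun k => hasFDerivAt_pi.mpr fun l => hR a b k l).prodMk
    (hasFDerivAt_pi.mpr fun a => hasFDerivAt_pi.mpr fun k => hN a k)), fun i => ?_⟩
  rfl

/-- **(hδT)** the Leibniz form of the derivative of the transgression sums:
`β ∂ᵢTₖ(i) = (-4)ᵏ top(θⁱ 𝒟ᵢ)`. [cite: Chern1945, (4)] -/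
theorem β_mul_coordPartial_T {x : Fin d → ℝ} (hx : x ∈ S.W) (k : Fin (d / 2)) (i : Fin d) :
    Fock.β d * coordPartial i (fun y => chernTransgressionSum S.g S.V y k i) x =
      (-4 : ℝ) ^ (k : ℕ) * Fock.top (Fock.θ i * Fock.leibnizD (S.g x *ᵥ unitField S.g S.V x)
        (fun a k => covDerivUnitField S.g S.V x a k) (coordRiemann S.g x)
        (fun a i => coordPartial i (fun y => (S.g y *ᵥ unitField S.g S.V y) a) x)
        (fun a k i => coordPartial i (fun y => covDerivUnitField S.g S.V y a k) x)
        (fun a b k l m => coordPartial m (fun y => coordRiemann S.g y a b k l) x) i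
        (d - 1 - 2 * (k : ℕ)) k) := by
  obtain ⟨D, hD, hDv⟩ := S.hasFDerivAt_coeffMap hx
  set Φ : Arr d → ℝ := fun p => Fock.tgSum p.1 p.2.1 p.2.2 k i with hΦ
  have hΦd : DifferentiableAt ℝ Φ (S.coeffMap x) := differentiable_tgSum k i _
  -- chain rule
  have hT : (fun y => chernTransgressionSum S.g S.V y k i) = Φ ∘ S.coeffMap := rfl
  have hcomp := hΦd.hasFDerivAt.comp x hD
  rw [hT, coordPartial, hcomp.fderiv, ContinuousLinearMap.comp_apply, hDv]
  set v : Arr d := (fun a => coordPartial i (fun y => (S.g y *ᵥ unitField S.g S.V y) a) x,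
    (fun a b k l => coordPartial i (fun y => coordRiemann S.g y a b k l) x,
      fun a k => coordPartial i (fun y => covDerivUnitField S.g S.V y a k) x)) with hv
  -- the line derivative
  have hline : HasDerivAt (fun t : ℝ => Φ (S.coeffMap x + t • v)) (fderiv ℝ Φ (S.coeffMap x) v) 0 :=
    hΦd.hasFDerivAt.hasLineDerivAt v
  -- the polynomial expansion along the line
  obtain ⟨b, n₀, hb⟩ := Fock.top_θ_perturb (S.g x *ᵥ unitField S.g S.V x)
    (fun a k => covDerivUnitField S.g S.V x a k) (coordRiemann S.g x)
    (fun a i => coordPartial i (fun y => (S.g y *ᵥ unitField S.g S.V y) a) x)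
    (fun a k i => coordPartial i (fun y => covDerivUnitField S.g S.V y a k) x)
    (fun a b k l m => coordPartial m (fun y => coordRiemann S.g y a b k l) x) i (d - 1 - 2 * (k : ℕ)) k
  set A₀ := Fock.top (Fock.θ i * (Fock.Sop (S.g x *ᵥ unitField S.g S.V x) *
    Fock.Hop (fun a k => covDerivUnitField S.g S.V x a k) ^ (d - 1 - 2 * (k : ℕ)) *
    Fock.Ωop (coordRiemann S.g x) ^ (k : ℕ))) with hA₀
  set A₁ := Fock.top (Fock.θ i * Fock.leibnizD (S.g x *ᵥ unitField S.g S.V x)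
    (fun a k => covDerivUnitField S.g S.V x a k) (coordRiemann S.g x)
    (fun a i => coordPartial i (fun y => (S.g y *ᵥ unitField S.g S.V y) a) x)
    (fun a k i => coordPartial i (fun y => covDerivUnitField S.g S.V y a k) x)
    (fun a b k l m => coordPartial m (fun y => coordRiemann S.g y a b k l) x) i (d - 1 - 2 * (k : ℕ)) k)
    with hA₁
  have hβ := Fock.β_ne_zero (d := d)
  have hfun : (fun t : ℝ => Φ (S.coeffMap x + t • v)) = fun t =>
      (Fock.β d)⁻¹ * ((-4 : ℝ) ^ (k : ℕ) * (A₀ + t * A₁ + t ^ 2 * ∑ r ∈ Finset.range n₀, t ^ r * b r)) := by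
    funext t
    have hbr := Fock.β_mul_tgSum_eq_top (fun a => (S.g x *ᵥ unitField S.g S.V x) a + t *
        coordPartial i (fun y => (S.g y *ᵥ unitField S.g S.V y) a) x)
      (fun a k' => covDerivUnitField S.g S.V x a k' + t * coordPartial i
        (fun y => covDerivUnitField S.g S.V y a k') x)
      (fun a b k' l => coordRiemann S.g x a b k' l + t * coordPartial i
        (fun y => coordRiemann S.g y a b k' l) x) k i
    rw [hb t] at hbr
    have hΦt : Φ (S.coeffMap x + t • v) = Fock.tgSum (fun a => (S.g x *ᵥ unitField S.g S.V x) a + t *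
        coordPartial i (fun y => (S.g y *ᵥ unitField S.g S.V y) a) x)
      (fun a b k' l => coordRiemann S.g x a b k' l + t * coordPartial i
        (fun y => coordRiemann S.g y a b k' l) x)
      (fun a k' => covDerivUnitField S.g S.V x a k' + t * coordPartial i
        (fun y => covDerivUnitField S.g S.V y a k') x) k i := by
      simp only [hΦ, coeffMap, hv, Prod.fst_add, Prod.snd_add, Prod.smul_fst, Prod.smul_snd]
      rfl
    rw [hΦt, ← hA₀, ← hA₁] at *
    field_simp
    linear_combination hbr
  have hderiv : HasDerivAt (fun t : ℝ => Φ (S.coeffMap x + t • v))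
      ((Fock.β d)⁻¹ * ((-4 : ℝ) ^ (k : ℕ) * A₁)) 0 := by
    rw [hfun]
    exact ((hasDerivAt_quadratic_expansion A₀ A₁ b n₀).const_mul _).const_mul _
  rw [hline.unique hderiv]
  field_simp

/-- The transgression sums are differentiable at points of `W`. [folklore] -/
theorem differentiableAt_T {x : Fin d → ℝ} (hx : x ∈ S.W) (k : Fin (d / 2)) (i : Fin d) :
    DifferentiableAt ℝ (fun y => chernTransgressionSum S.g S.V y k i) x := by
  obtain ⟨D, hD, -⟩ := S.hasFDerivAt_coeffMap hx
  have hT : (fun y => chernTransgressionSum S.g S.V y k i) =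
      (fun p : Arr d => Fock.tgSum p.1 p.2.1 p.2.2 k i) ∘ S.coeffMap := rfl
  rw [hT]
  exact (differentiable_tgSum k i _).comp x hD.differentiableAt

end ChernSetting

end ArrayCalculus

/-! ### The discharge -/

/-- **Chern's transgression identity in coordinates** (Chern 1945, (11): `-dΠ = Ω` on the unit
sphere bundle, pulled back by the unit field; here `∑ᵢ ∂ᵢΠᵢ = E`). Proof: the pointwise algebraic
identity `Fock.chern_pointwise` (Mathai–Quillen form of Chern's recursion, in the Fock model of the
Grassmann algebra) fed with the coordinate identities (A1)–(A3), (S1)–(S4) and the Leibniz form of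
`∂ᵢTₖ(i)` established above. [cite: Chern1945, (11)] -/
theorem div_chernTransgression_eq_eulerDensity_holds : div_chernTransgression_eq_eulerDensity := by
  intro d hd U W g V hU hW hWU hg hgs hV hV0 x hx
  obtain ⟨p, hp⟩ := hd
  -- the setting
  let S : ChernSetting d := ⟨U, W, g, V, hU, hW, hWU, hg, hgs, hV, hV0⟩
  have hxW : x ∈ S.W := hx
  have hxU : x ∈ S.U := hWU hx
  rcases Nat.eq_zero_or_pos p with rfl | hp0
  · -- `d = 0`: there is no nonzero vector, the hypothesis `V x ≠ 0` is contradictory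
    exfalso
    refine hV0 x hx (funext fun j => ?_)
    have : d = 0 := by omega
    subst this
    exact Fin.elim0 j
  -- abbreviations for the pointwise data
  set ρ : ℝ := (Real.sqrt (g x).det)⁻¹ with hρ
  set δρ : Fin d → ℝ := fun i => coordPartial i (fun y => (Real.sqrt (g y).det)⁻¹) x with hδρ
  set δT : Fin (d / 2) → Fin d → ℝ := fun k i =>
    coordPartial i (fun y => chernTransgressionSum g V y k i) x with hδT
  -- the divergence, computed by the product rule
  have hdiv : ∀ i : Fin d, coordPartial i (chernTransgression g V i) x =
      -(δρ i * ∑ k : Fin (d / 2), chernTransgressionCoeff d k * chernTransgressionSum g V x k i +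
        ρ * ∑ k : Fin (d / 2), chernTransgressionCoeff d k * δT k i) := by
    intro i
    have hρd : DifferentiableAt ℝ (fun y => (Real.sqrt (g y).det)⁻¹) x :=
      differentiableAt_of_contDiffOn S.cd_ρ S.hU hxU (by norm_num)
    have hTd : ∀ k : Fin (d / 2), DifferentiableAt ℝ
        (fun y => chernTransgressionCoeff d k * chernTransgressionSum g V y k i) x := fun k =>
      (S.differentiableAt_T hxW k i).const_mul _
    have hsum : DifferentiableAt ℝ (fun y => ∑ k : Fin (d / 2),
        chernTransgressionCoeff d k * chernTransgressionSum g V y k i) x :=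
      DifferentiableAt.fun_sum fun k _ => hTd k
    have e : chernTransgression g V i = fun y => -((Real.sqrt (g y).det)⁻¹ *
        ∑ k : Fin (d / 2), chernTransgressionCoeff d k * chernTransgressionSum g V y k i) := rfl
    have hk : ∑ k : Fin (d / 2), coordPartial i
        (fun y => chernTransgressionCoeff d k * chernTransgressionSum g V y k i) x =
        ∑ k : Fin (d / 2), chernTransgressionCoeff d k * δT k i :=
      Finset.sum_congr rfl fun k _ => coordPartial_const_mul i (S.differentiableAt_T hxW k i)
        (chernTransgressionCoeff d k)
    rw [e, coordPartial_neg, coordPartial_mul _ hρd hsum, coordPartial_sum _ _ fun k _ => hTd k, hk]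
  -- the pointwise identity
  have key := Fock.chern_pointwise (S.g x *ᵥ unitField S.g S.V x) (unitField S.g S.V x)
    (fun a k => covDerivUnitField S.g S.V x a k) (coordRiemann S.g x)
    (fun a k b => coordChristoffel S.g x a k b)
    (fun a i => coordPartial i (fun y => (S.g y *ᵥ unitField S.g S.V y) a) x)
    (fun a k i => coordPartial i (fun y => covDerivUnitField S.g S.V y a k) x)
    (fun a b k l m => coordPartial m (fun y => coordRiemann S.g y a b k l) x)
    (p := p) (by omega) hp0 ρ δρ (S.A1 hxW) (S.A2 hxW) (S.A3 hxU) (S.S1 hxW) (S.S2 hxW)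
    (S.S3 hxU) (fun i => S.S4 hxU i) δT (fun k i => S.β_mul_coordPartial_T hxW k i)
  -- assemble
  rw [Finset.sum_congr rfl fun i _ => hdiv i, Finset.sum_neg_distrib]
  have hE : eulerDensity g x = ρ * ((4 : ℝ) ^ (d / 2) * ((d / 2)! : ℕ))⁻¹ * eulerDensitySum g x := by
    rw [eulerDensity, hρ, mul_inv]
    ring
  rw [hE, Fock.eulerDensitySum_eq_eSum]
  exact key

end Literature.Geometry.Riemannian
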